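import Summits.AtomisticToContinuum.HydrodynamicLimit.Theorems.BoxDissipativeWeakStrongLocalGibbsFineScaleUniformTwoPt

/-!
# `LocalGibbsFineScale` (route `BoxDissipativeWeakStrong`), file 4b: the variance of a kernel average,
uniformly in the centre

Support lemma for item stmt-AtomisticToContinuum-9905: for a family of averaging kernels
`g_N(x, ·) ≥ 0` (measurable, bounded by `C_N`, unit mass, supported in the sup-ball of radius
`r_N → 0` around `x`) at a kinetic window `C_N/(N+1) → 0` and the empirical average
`A_N(x)(q) = (N+1)⁻¹ ∑ᵢ g_N(x, qᵢ)` of the `N+1`-particle canonical hard-sphere gas at small reduced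
density,

  `∀ δ > 0, ∀ᶠ N, ∀ x, Ξ_N(N+1)⁻¹ ∫ (A_N(x) - E[g_N(x,q₀)])² 𝟙[hard core] dμ^{⊗(N+1)} ≤ δ`

(`variance_kernel_uniform`): the variance identity of `HardSphereEulerLLN` with the uniform one- and
two-point limits of the previous files and `E[g²] ≤ 2 C_N M`.
-/

noncomputable section

namespace Summit.AtomisticToContinuum.HydrodynamicLimit.Theorems
namespace LGFS
open MeasureTheory Finset Filter Topology Metric
open Literature.Probability.LatticeModels Literature.MathematicalPhysics.StatisticalMechanics
  Literature.MathematicalPhysics.KineticTheory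
open scoped ENNReal

variable {P : DensityProfile} {σ : ℝ}

/-! ### The variance of the kernel average -/

/-- **Uniform variance bound at a kinetic window.** For a kernel family as above
(`r_N → 0`, `C_N/(N+1) → 0`) and the empirical average `A_N(x)(q) = (N+1)⁻¹ ∑ᵢ g_N(x, qᵢ)`:
`∀ δ > 0, ∀ᶠ N, ∀ x, Ξ_N(N+1)⁻¹ ∫ (A_N(x) - E[g_N(x,q₀)])² 𝟙[hard core] dμ^{⊗(N+1)} ≤ δ`. -/
theorem variance_kernel_uniform (hs : SmallDensity P σ) {g : ℕ → T3 → T3 → ℝ} {Cg r : ℕ → ℝ}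
    (hgm : ∀ N x, Measurable (g N x)) (hg0 : ∀ N x y, 0 ≤ g N x y) (hgC : ∀ N x y, g N x y ≤ Cg N)
    (hg1 : ∀ N x, ∫ y, g N x y = 1) (hsupp : ∀ N x y, g N x y ≠ 0 → dist y x < r N)
    (hr : Tendsto r atTop (𝓝 0)) (hwin : Tendsto (fun N : ℕ => Cg N / ((N : ℝ) + 1)) atTop (𝓝 0))
    {δ : ℝ} (hδ : 0 < δ) :
    ∀ᶠ N in atTop, ∀ x,
      (∫ q, ((((N + 1 : ℕ) : ℝ))⁻¹ * ∑ i, g N x (q i) - onePt P σ (g N x) N 0) ^ 2 *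
          efR (Ov (hsDiameter σ N)) q univ ∂Measure.pi (fun _ : Fin (N + 1) => P.μ)) /
        XiN P σ N (N + 1) ≤ δ := by
  have hM := P.M_pos
  have hθ1 := hs.geomRatio_lt_one
  set ρm := 2 * Real.exp 1 * P.M / (1 - geomRatio P σ) with hρm
  have hρm0 : 0 ≤ ρm := by rw [hρm]; exact div_nonneg (by positivity) (by linarith)
  -- small parameters
  obtain ⟨η₁, hη₁, hη₁le⟩ := exists_pos_mul_le (ε := δ / 4) (K := 2 * P.M + 2 * ρm) (by positivity)
    (by positivity)
  have hE1 := onePt_kernel_uniform hs hgm hg0 hgC hg1 hsupp hr 0 (lt_min hη₁ one_pos)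
  have hE2 := twoPt_kernel_uniform hs hgm hg0 hgC hg1 hsupp hr hwin (by positivity : (0 : ℝ) < δ / 4)
  have hE3 : ∀ᶠ N : ℕ in atTop, ((N : ℝ) + 1)⁻¹ * (ρm ^ 2 + δ / 4) ≤ δ / 4 := by
    have h : Tendsto (fun N : ℕ => ((N : ℝ) + 1)⁻¹ * (ρm ^ 2 + δ / 4)) atTop (𝓝 0) := by
      have h0 : Tendsto (fun N : ℕ => ((N : ℝ) + 1)⁻¹) atTop (𝓝 0) :=
        tendsto_inv_atTop_zero.comp (tendsto_natCast_atTop_atTop.atTop_add tendsto_const_nhds)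
      simpa using h0.mul_const (ρm ^ 2 + δ / 4)
    exact (h.eventually (ge_mem_nhds (by positivity : (0 : ℝ) < δ / 4))).mono fun N hN => hN
  have hE4 : ∀ᶠ N : ℕ in atTop, 2 * P.M * (Cg N / ((N : ℝ) + 1)) ≤ δ / 4 := by
    have := hwin.const_mul (2 * P.M)
    rw [mul_zero] at this
    exact (this.eventually (ge_mem_nhds (by positivity : (0 : ℝ) < δ / 4))).mono fun N hN => hN
  have hE5 : ∀ᶠ N : ℕ in atTop, 1 ≤ N := eventually_ge_atTop 1
  filter_upwards [hE1, hE2, hE3, hE4, hE5] with N hN1 hN2 hN3 hN4 hN5 x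
  have hlam1 := hs.ovDensity_lt_one
  have h2 : 2 ≤ N + 1 := by omega
  have hgxm := hgm N x
  have hgxC' : ∀ y, |g N x y| ≤ Cg N := abs_le_of_nonneg_of_le (hg0 N x) (hgC N x)
  have hI : ∫ y, g N x y ∂P.μ ≤ P.M := integral_kernel_μ_le P hgxm (hg0 N x) (hgC N x) (hg1 N x)
  have hXi := XiN_pos hs.σ_pos.le hs.σ_lt_half hlam1 (N := N) (m := N + 1) le_rfl
  set m := onePt P σ (g N x) N 0 with hm
  -- the variance identity
  rw [XiN, variance_identity P (hsDiameter σ N) h2 hgxm hgxC' m (by rw [← XiN]; exact hXi.ne')]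
  have hq : Md P (hsDiameter σ N) (N + 1) (fun y => g N x y ^ 2) (N + 1) / Xi P (hsDiameter σ N) (N + 1) (N + 1) =
      onePt P σ (fun y => g N x y ^ 2) N 0 := by rw [onePt, XiN]; rfl
  have hm' : Md P (hsDiameter σ N) (N + 1) (g N x) (N + 1) / Xi P (hsDiameter σ N) (N + 1) (N + 1) = m := by
    rw [hm, onePt, XiN]; rfl
  have ht : (∫ q, g N x (q 0) * g N x (q ⟨1, h2⟩) * efR (Ov (hsDiameter σ N)) q univ
      ∂Measure.pi (fun _ : Fin (N + 1) => P.μ)) / Xi P (hsDiameter σ N) (N + 1) (N + 1) =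
      twoPt P σ (g N x) N := by rw [twoPt, dif_pos h2, XiN]
  rw [hq, hm', ht]
  -- bounds on the pieces
  have hn : (((N + 1 : ℕ) : ℝ))⁻¹ = ((N : ℝ) + 1)⁻¹ := by push_cast; rfl
  rw [hn]
  have hn0 : 0 ≤ ((N : ℝ) + 1)⁻¹ := by positivity
  have hn1 : ((N : ℝ) + 1)⁻¹ ≤ 1 := inv_le_one_of_one_le₀ (by linarith [(Nat.cast_nonneg N : (0 : ℝ) ≤ N)])
  have hsq : onePt P σ (fun y => g N x y ^ 2) N 0 ≤ 2 * Cg N * P.M :=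
    (onePt_sq_le hs hgxm (hg0 N x) (hgC N x) (Nat.zero_le N)).trans
      (by have := (hg0 N x x).trans (hgC N x x); nlinarith)
  have hsq0 : 0 ≤ onePt P σ (fun y => g N x y ^ 2) N 0 :=
    MesoLLN.onePt_nonneg hs (fun y => sq_nonneg _) N 0
  have hmρ : |m - rhoLim P σ x| ≤ min η₁ 1 := hN1 x
  have hρ : |rhoLim P σ x| ≤ ρm := abs_rhoLim_le hs x
  have htwo : |twoPt P σ (g N x) N - rhoLim P σ x ^ 2| ≤ δ / 4 := hN2 x
  -- `m² - ρ₀²` and `|twoPt|`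
  have hmsq : |m ^ 2 - rhoLim P σ x ^ 2| ≤ δ / 4 := by
    have hfac : m ^ 2 - rhoLim P σ x ^ 2 = (m - rhoLim P σ x) * (m - rhoLim P σ x + 2 * rhoLim P σ x) := by
      ring
    rw [hfac, abs_mul]
    have hb : |m - rhoLim P σ x + 2 * rhoLim P σ x| ≤ 1 + 2 * ρm := by
      calc |m - rhoLim P σ x + 2 * rhoLim P σ x| ≤ |m - rhoLim P σ x| + |2 * rhoLim P σ x| := abs_add_le _ _
        _ ≤ 1 + 2 * ρm := by
            rw [abs_mul, abs_two]
            exact add_le_add (hmρ.trans (min_le_right _ _)) (by linarith)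
    calc |m - rhoLim P σ x| * |m - rhoLim P σ x + 2 * rhoLim P σ x| ≤ η₁ * (1 + 2 * ρm) :=
          mul_le_mul (hmρ.trans (min_le_left _ _)) hb (abs_nonneg _) hη₁.le
      _ ≤ (2 * P.M + 2 * ρm) * η₁ := by
          have := MesoLLN.one_le_M P
          nlinarith
      _ ≤ δ / 4 := hη₁le
  have htwoabs : |twoPt P σ (g N x) N| ≤ ρm ^ 2 + δ / 4 := by
    have h := abs_sub_abs_le_abs_sub (twoPt P σ (g N x) N) (rhoLim P σ x ^ 2)
    have h' : |rhoLim P σ x ^ 2| ≤ ρm ^ 2 := by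
      rw [abs_pow]; exact pow_le_pow_left₀ (abs_nonneg _) hρ 2
    linarith
  -- conclusion
  have hexpr : ((N : ℝ) + 1)⁻¹ * onePt P σ (fun y => g N x y ^ 2) N 0 +
      (1 - ((N : ℝ) + 1)⁻¹) * twoPt P σ (g N x) N - 2 * m * m + m ^ 2 =
      ((N : ℝ) + 1)⁻¹ * onePt P σ (fun y => g N x y ^ 2) N 0 - ((N : ℝ) + 1)⁻¹ * twoPt P σ (g N x) N +
        (twoPt P σ (g N x) N - rhoLim P σ x ^ 2) - (m ^ 2 - rhoLim P σ x ^ 2) := by ring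
  rw [hexpr]
  have hA1 : ((N : ℝ) + 1)⁻¹ * onePt P σ (fun y => g N x y ^ 2) N 0 ≤ δ / 4 := by
    calc ((N : ℝ) + 1)⁻¹ * onePt P σ (fun y => g N x y ^ 2) N 0 ≤ ((N : ℝ) + 1)⁻¹ * (2 * Cg N * P.M) :=
          mul_le_mul_of_nonneg_left hsq hn0
      _ = 2 * P.M * (Cg N / ((N : ℝ) + 1)) := by ring
      _ ≤ δ / 4 := hN4
  have hA2 : |((N : ℝ) + 1)⁻¹ * twoPt P σ (g N x) N| ≤ δ / 4 := by
    rw [abs_mul, abs_of_nonneg hn0]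
    exact (mul_le_mul_of_nonneg_left htwoabs hn0).trans hN3
  have hx1 := neg_abs_le (((N : ℝ) + 1)⁻¹ * twoPt P σ (g N x) N)
  have hx2 := le_abs_self (twoPt P σ (g N x) N - rhoLim P σ x ^ 2)
  have hx3 := neg_abs_le (m ^ 2 - rhoLim P σ x ^ 2)
  linarith

end LGFS
end Summit.AtomisticToContinuum.HydrodynamicLimit.Theorems
end
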